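import Mathlib.Analysis.Complex.ExponentialBounds
import Literature.Computability.Cryptography.LWEHardness
import Literature.Computability.Cryptography.StatisticalDistanceMixtures
import Literature.Algebra.EuclideanLattices.DualLattice
import Literature.Algebra.EuclideanLattices.SmoothingParameterBounds
import HarnessLib

/-!
# Peikert's classical `GapSVP_{ζ,γ} → LWE` reduction (STOC 2009, Thm. 3.1): the architecture of the proof of `peikert_gapSVPZeta_to_lwe_classical`

Topic `Computability/Cryptography` (family `pqc`). Companion of `LWEHardness.lean` for the named fact
`Literature.Computability.Cryptography.peikert_gapSVPZeta_to_lwe_classical` (**pqc.S20**; Peikert,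
STOC 2009, Thm. 3.1: a classical probabilistic polynomial-time reduction from `GapSVP_{ζ,γ}` to
search-`LWE_{q,Ψ_α}` for `γ ≥ n/(α√(log n))`, `ζ ≥ γ`, `q ≥ (ζ/√n)·ω(√(log n))`), in the style of
`RegevDGSReduction.lean` / `RegevReduction.lean` for pqc.S19. Everything here is PROVED and no named
fact is introduced (D-0026): the two printed components of the proof are explicit hypotheses of the
assembly theorem, and the mathematics of the first component is proved outright.

The author's architecture (STOC version §3.1.2, p. 337): *"Conceptually, the reduction claimed in
Theorem 3.1 has two components. The first piece reduces GapSVP to a version of the bounded-distance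
decoding (BDD) problem. The second part is the reduction `R` from BDD to LWE described in
Proposition 3.2, with a concrete implementation of the oracle `D`."* The first piece (full version
pp. 11–12): on `(B, d)`, repeat `poly(n)` times — perturb, `x = w mod B` with `w` uniform in `d'·Bₙ`,
`d' = d√(n/(4 log n))`; call `R` on `(B, x)` with `r = q√(2n)/(γd)`; accept iff some answer `v ≠ x - w`.
NO instances (`λ₁ > γd`): the call satisfies the hypotheses of Prop. 3.2/2.8 (Lemma 2.7) and its
answer is forced to be `x - w`. YES instances (`λ₁ ≤ d`): by Lemma 2.1 [GG00] the perturbation is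
statistically hidden, `Pr[R(x) = x - w] ≤ 1 - 1/poly(n)` for ANY `R`.

## Results

* Glue (definitions with bodies): `Peikert2009.BDDAdmissible q α f ((B, x), r)` — the hypotheses of
  Prop. 3.2 with Prop. 2.8 on the reversed dual basis (Lemma 2.3: `‖d̃ᵢ‖ = 1/‖b̃ᵢ‖`) at `ε = 2⁻ⁿ`, for the
  growth witness `f` (`f√(log n)` an `ω(√(log n))` function): `B` nonsingular, `r > 0`,
  `f√(log n) ≤ r‖b̃ᵢ‖`, `√2 q η_{2⁻ⁿ}(Λ*) ≤ r`, `dist(x, Λ) ≤ αq/(√2 r)`; `Peikert2009.bddSuccess` (the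
  answer decodes to a closest vector, `CVP.IsSolution 1`); `Peikert2009.SolvesBDD q α f R coins fuel O`
  (`R^O` succeeds on every `f`-admissible input of dimension `n` with probability `≥ 1 - n⁻ᶜ`, every `c`,
  eventually); `Peikert2009.perturbRadius n d = d√n/(2√(log n))` (Peikert's `d'`);
  `peikertGamma α n = max(1, 2n/(α√(log n)))`.
* **NO case, PROVED** (`Peikert2009.no_case`, from `sqrt_two_mul_mul_smoothingParameter_dual_le`,
  `bddAdmissible_of_le_minNorm`, `eq_target_sub_of_isSolution`): on a NO instance of `GapSVP_{ζ,γ}` in the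
  regime of Thm. 3.1 (`γ ≥ 2n/(α√(log n))`, `q ≥ ζ f√(log n)/√n`), for every perturbation `w ∈ ℤⁿ` with
  `‖w‖ ≤ d'`, every target `x ≡ w (mod L(B))` and every rational `r ∈ [r₀, 2r₀]`, `r₀ = q√(2n)/(γd)`, the
  call `((B, x), r)` is `f`-admissible and its only admissible answer is `x - w`. The smoothing step is
  Lemma 2.7 = Micciancio–Regev 2007, Lemma 3.2, the tree THEOREM
  `smoothingParameter_two_pow_neg_le_holds`, applied to `Λ*` with `(Λ*)* = Λ` (`dualLattice_dualLattice`).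
* **YES case, PROVED** (`Peikert2009.toReal_toOuterMeasure_le_of_shift`,
  `toReal_toOuterMeasure_bind_le_of_shift`, `prob_names_perturbation_le`): for ANY law `W` of the
  perturbation, ANY shift-invariant view `red` (`red (z + w) = red w`, as `w mod B` for `z ∈ L(B)`), ANY
  answer computed from the view and from coins independent of `w`, the probability of naming the
  perturbation is `≤ (1 + Δ(W, z + W))/2` (`z ≠ 0`): naming `w` and naming `z + w` from the same view are
  incompatible events, whose probabilities differ by at most `Δ(W, z + W)`. With Lemma 2.1
  (`Δ ≤ 1 - 1/poly(n)` for `‖z‖ ≤ d`, `W = U(d'·Bₙ)`) this is the printed `Pr[R(x) = x - w] ≤ 1 - 1/poly(n)`.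
* Parameter bookkeeping, PROVED: `isSoftBigO_peikertGamma` (`γ = Õ(n/α)`), `eventually_two_le_modulus`
  (S20's `q ≥ ζ f√(log n)/√n`, `ζ ≥ γ`, forces Prop. 3.2's `q ≥ 2` eventually).
* **Assembly, PROVED**: `peikert_gapSVPZeta_to_lwe_classical_of_components h₁ h₂ :
  peikert_gapSVPZeta_to_lwe_classical q α m`, where `h₁` is the first component in machine form (from
  any probabilistic polynomial-time `R`, a probabilistic polynomial-time `M` deciding `GapSVP_{ζ,γ}`
  with probability `≥ 2/3` whenever `R^O` solves the `f`-admissible BDD inputs) and `h₂` the second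
  (Prop. 3.2 with Prop. 2.8: ONE probabilistic polynomial-time `R` solving the `f`-admissible inputs with
  overwhelming probability for every oracle solving search-`LWE_{q,Ψ̄_α}`). So the unproved content of
  pqc.S20 is exactly: the machine `M` of `h₁` with a perturbation law samplable to negligible error
  satisfying Lemma 2.1, and `h₂` (GPV sampling, Regev's Lemma 3.4 analysis — Regev 2009 Claims 3.8–3.10,
  of which Claim 3.8 is the tree theorem `abs_gaussianMass_div_sub_one_le_holds` and Claims 3.9–3.10 are
  absent —, and the oracle normalisations of Regev 2009, Lemmas 3.5–3.7, 4.1, 4.3).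

## Faithfulness notes

* Thm. 3.1 verbatim (full version p. 10): "Let `α = α(n) ∈ (0,1)` be a real number and
  `γ = γ(n) ≥ n/(α√(log n))`. Let `ζ = ζ(n) ≥ γ` and `q = q(n) ≥ (ζ/√n)·ω(√(log n))`. There is a (classical)
  probabilistic polynomial-time reduction from solving `GapSVP_{ζ,γ}` in the worst case (with
  overwhelming probability) to solving `LWE_{q,Ψ_α}` with non-negligible probability (for uniformly
  random `s ∈ ℤ_qⁿ`) using a polynomial number of samples." The LWE oracle of S20, `h₁`, `h₂` is the one
  fixed by `LWEHardness.lean` (deterministic, search-`LWE_{q,Ψ̄_α}` with discretised noise, `m(n)` samples,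
  average-case probability `≥ 2/3`), at least as strong as the printed hypothesis (`2/3` is
  non-negligible; a `Ψ̄_α`-oracle serves a `Ψ_α`-caller by rounding `q·b`, Regev 2009, Lemma 4.3).
* Reals versus integers: Peikert samples `w` from the real ball and works with exact reals ("all the
  arguments can be made rigorous by using a suitable amount of precision", full version p. 7). The
  tree's CVP targets are integer vectors, so the perturbation is an integer vector here and the
  admissibility lemma is stated scale-free (`bddAdmissible_of_le_minNorm`: Gram–Schmidt norms `≥ s`,
  `f√(log n) ≤ r s`), to be applied by `M` to a scaled copy `(MB, Md)` of the instance when it needs a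
  finer perturbation grid; `γ ≥ 2n/(α√(log n))` (twice the printed bound; `γ` is existential in S20)
  pays for a rational `r` within a factor `2` of `q√(2n)/(γd)`. `log` is `Real.log`; the base only
  moves constants into `f = ω(1)`.
* The hiding lemma is stated for an arbitrary perturbation law `W` (Peikert: `U(d'·Bₙ)`), since only
  `Δ(W, z + W) ≤ 1 - 1/poly(n)` and the norm bound `d'` are used (p. 12); a spherical Gaussian of
  `ℓ₂`-width `d'` serves equally.

## References

* C. Peikert, *Public-key cryptosystems from the worst-case shortest vector problem*, STOC 2009,
  333–342, §3.1 (Thm. 3.1, Prop. 3.2, §3.1.2 p. 337); full version, Dagstuhl Seminar Proc. 08491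
  (2009), Lemma 2.1, Lemma 2.3, Def. 2.5, Lemma 2.7, Prop. 2.8, Thm. 3.1, Prop. 3.2 and the proof of
  Thm. 3.1 (pp. 7–12) [Peikert2009] (read: `lit read doi:10.4230/dagsemproc.08491.4`, pp. 7–12).
* O. Regev, *On lattices, learning with errors, random linear codes, and cryptography*, J. ACM 56
  (2009), Lemmas 3.4–3.7, Claims 3.8–3.10, Lemmas 4.1, 4.3 [RegevLWE2009].
* C. Gentry, C. Peikert, V. Vaikuntanathan, *Trapdoors for hard lattices and new cryptographic
  constructions*, STOC 2008, Thm. 4.1 [GentryPeikertVaikuntanathan2008].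
* O. Goldreich, S. Goldwasser, *On the limits of nonapproximability of lattice problems*, J. Comput.
  Syst. Sci. 60 (2000) 540–563 [GoldreichGoldwasser2000].
* D. Micciancio, O. Regev, *Worst-case to average-case reductions based on Gaussian measures*,
  SIAM J. Comput. 37 (2007), Lemma 3.2 [MicciancioRegev2007].
-/

noncomputable section

open Filter Asymptotics Computability Metric Literature.Computability.Complexity
  Literature.Computability.Cryptography.LWE Literature.Algebra.EuclideanLattices
  Literature.Computability.Cryptography
open scoped ENNReal

namespace Literature.Computability.Cryptography

namespace Peikert2009

/-! ### Inputs `((B, x), r)` of the BDD-to-LWE reduction and their admissibility -/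

/-- LOCAL GLUE. Admissibility of an input `((B, x), r)` (integer basis `B` of dimension `n`, integer
target `x`, rational parameter `r`; coded as a `GapCVPInstance`) for Peikert's BDD-to-LWE reduction
`R` of Prop. 3.2 with the `D_{Λ*,r}`-oracle implemented by the GPV sampler on the reversed dual basis
(proof of Thm. 3.1, step 2), relative to the growth witness `f` (`f → ∞`, so that `f(n)√(log n)` is
an `ω(√(log n))` function): (i) `B` nonsingular, `r > 0`; (ii) `f(n)√(log n) ≤ r · ‖b̃ᵢ‖` for all
`i` — Prop. 2.8's hypothesis `r ≥ maxᵢ‖d̃ᵢ‖ · ω(√(log n))` for the reversed dual basis, rewritten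
through Lemma 2.3 (`‖d̃ᵢ‖ = 1/‖b̃ᵢ‖`); (iii) `√2 · q(n) · η_{2⁻ⁿ}(Λ*) ≤ r` (Prop. 3.2 with
`ε(n) = 2⁻ⁿ`, `Λ = L(B)`); (iv) `dist(x, Λ) ≤ α(n) q(n)/(√2 r)` (Prop. 3.2). Gram–Schmidt vectors
are Mathlib's `InnerProductSpace.gramSchmidt` of the rows in their given order, as in
`GapSVPZeta.Promise`. [cite: Peikert2009, Prop. 3.2 and Prop. 2.8 with Lemma 2.3 (full version pp. 8–12)] -/
def BDDAdmissible (q : ℕ → ℕ) (α f : ℕ → ℝ) (p : GapCVPInstance) : Prop :=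
  p.1.I.IsNonsingular ∧ 0 < p.2 ∧
    (∀ i, f p.1.I.n * Real.sqrt (Real.log p.1.I.n) ≤
      (p.2 : ℝ) * ‖InnerProductSpace.gramSchmidt ℝ p.1.I.vec i‖) ∧
    Real.sqrt 2 * q p.1.I.n *
        smoothingParameter (dualLattice p.1.I.lattice) ((2⁻¹ : ℝ) ^ p.1.I.n) ≤ (p.2 : ℝ) ∧
    infDist p.1.targetE p.1.I.lattice ≤ α p.1.I.n * q p.1.I.n / (Real.sqrt 2 * p.2)

/-- Admissibility is antitone in the growth witness: a larger `f` only strengthens condition (ii).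
[folklore] -/
theorem BDDAdmissible.anti {q : ℕ → ℕ} {α f f' : ℕ → ℝ} (hff' : ∀ n, f n ≤ f' n) {p : GapCVPInstance}
    (h : BDDAdmissible q α f' p) : BDDAdmissible q α f p := by
  obtain ⟨h1, h2, h3, h4, h5⟩ := h
  refine ⟨h1, h2, fun i => le_trans ?_ (h3 i), h4, h5⟩
  exact mul_le_mul_of_nonneg_right (hff' _) (Real.sqrt_nonneg _)

/-- LOCAL GLUE. The success event of a BDD solver with string output on the input `((B, x), r)`: the
output word (a timeout `none` reads as `[]`) decodes (`decodeIntVec`) to a vector `v ∈ L(B)` with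
`‖v - x‖ ≤ dist(x, L(B))`, i.e. to a closest lattice vector (`CVP.IsSolution` with factor `1`); under
admissibility (`dist(x, Λ) < λ₁/2`) this is "the (unique) `v ∈ Λ` closest to `x`" of Prop. 3.2.
[cite: Peikert2009, Prop. 3.2 (full version p. 11)] -/
def bddSuccess (p : GapCVPInstance) : Set (Option (List Bool)) :=
  {o | CVP.IsSolution (fun _ => 1) p.1 (decodeIntVec p.1.I.n (o.getD []))}

/-- LOCAL GLUE. `SolvesBDD q α f R coins fuel O`: run with random coins (`OracleAlg.randRun`) and oracle
`O`, the oracle algorithm `R` finds a closest vector on every `f`-admissible input of dimension `n`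
with overwhelming probability — for every `c`, eventually in `n`, with probability `≥ 1 - n⁻ᶜ`
(Prop. 3.2: "finds (the unique) `v ∈ Λ` closest to `x` with overwhelming probability"; worst case
over the admissible inputs). [cite: Peikert2009, Prop. 3.2 (full version p. 11)] -/
def SolvesBDD (q : ℕ → ℕ) (α f : ℕ → ℝ) (R : OracleAlg (List Bool)) (coins fuel : Polynomial ℕ)
    (O : Oracle) : Prop :=
  ∀ c : ℕ, ∀ᶠ n : ℕ in atTop, ∀ p : GapCVPInstance, p.1.I.n = n → BDDAdmissible q α f p →
    ENNReal.ofReal (1 - 1 / (n : ℝ) ^ c) ≤ (R.randRun O coins fuel p.encode).toOuterMeasure (bddSuccess p)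

/-- `SolvesBDD` is monotone in the growth witness: solving the `f`-admissible inputs solves the
(fewer) `f'`-admissible ones for `f ≤ f'`. [folklore] -/
theorem SolvesBDD.mono {q : ℕ → ℕ} {α f f' : ℕ → ℝ} (hff' : ∀ n, f n ≤ f' n) {R : OracleAlg (List Bool)}
    {coins fuel : Polynomial ℕ} {O : Oracle} (h : SolvesBDD q α f R coins fuel O) :
    SolvesBDD q α f' R coins fuel O :=
  fun c => (h c).mono fun _ hn p hp hadm => hn p hp (hadm.anti hff')

/-! ### NO instances: the call `((B, x), r)` is admissible and its answer is forced -/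

/-- **The Lemma 2.7 step of the NO case** (full version p. 12: "by Lemma 2.7, we have
`η_ε(Λ*) ≤ √n/(γ·d)` for `ε(n) = 2⁻ⁿ` … Therefore `r ≥ √2 q·η_ε(Λ*)` as required by Proposition 3.2"):
if `0 < d₀ ≤ λ₁(L(B))` and `r ≥ q√(2n)/d₀` then `√2 q η_{2⁻ⁿ}(L(B)*) ≤ r`. Lemma 2.7 is Micciancio–Regev
2007, Lemma 3.2, the tree theorem `smoothingParameter_two_pow_neg_le_holds`, applied to the dual
lattice, with `(Λ*)* = Λ` (`dualLattice_dualLattice`). [cite: Peikert2009, Lemma 2.7 and Thm. 3.1 proof (NO case, full version p. 12)] -/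
theorem sqrt_two_mul_mul_smoothingParameter_dual_le {I : LatticeInstance} (hI : I.IsNonsingular)
    {q d₀ r : ℝ} (hq : 0 ≤ q) (hd₀ : 0 < d₀) (hmin : d₀ ≤ minNorm I.lattice)
    (hr : q * Real.sqrt (2 * I.n) / d₀ ≤ r) :
    Real.sqrt 2 * q * smoothingParameter (dualLattice I.lattice) ((2⁻¹ : ℝ) ^ I.n) ≤ r := by
  haveI := LatticeInstance.isZLattice_of_isNonsingular hI
  have h := smoothingParameter_two_pow_neg_le_holds (dualLattice I.lattice)
  unfold smoothingParameter_two_pow_neg_le at h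
  rw [finrank_euclideanSpace_fin, dualLattice_dualLattice] at h
  have h' : smoothingParameter (dualLattice I.lattice) ((2⁻¹ : ℝ) ^ I.n) ≤ Real.sqrt I.n / d₀ :=
    h.trans (div_le_div_of_nonneg_left (Real.sqrt_nonneg _) hd₀ hmin)
  calc Real.sqrt 2 * q * smoothingParameter (dualLattice I.lattice) ((2⁻¹ : ℝ) ^ I.n)
      ≤ Real.sqrt 2 * q * (Real.sqrt I.n / d₀) :=
        mul_le_mul_of_nonneg_left h' (mul_nonneg (Real.sqrt_nonneg _) hq)
    _ = q * Real.sqrt (2 * I.n) / d₀ := by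
        rw [Real.sqrt_mul (by norm_num : (0:ℝ) ≤ 2)]; ring
    _ ≤ r := hr

/-- If `x - w ∈ L(B)` then `dist(x, L(B)) ≤ ‖w‖`. [folklore] -/
theorem infDist_targetE_le_norm (c : CVPInstance) {w : Fin c.I.n → ℤ}
    (hxw : c.targetE - intVecToEuclidean c.I.n w ∈ c.I.lattice) :
    infDist c.targetE c.I.lattice ≤ ‖intVecToEuclidean c.I.n w‖ := by
  refine (infDist_le_dist_of_mem hxw).trans_eq ?_
  rw [dist_eq_norm, sub_sub_cancel]

/-- **NO case, the answer is forced** (Peikert 2009, proof of Thm. 3.1: "λ₁(Λ) > γ·d > 2d', therefore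
the reduction from Proposition 3.2 must return `v = x - w`"): if `x - w ∈ L(B)` and `2‖w‖ < λ₁(L(B))`,
then the only closest vector to `x` — indeed the only `v ∈ L(B)` with `‖v - x‖ ≤ dist(x, L(B))`, the
success event `CVP.IsSolution 1` of `bddSuccess` — is `x - w`. [cite: Peikert2009, Thm. 3.1 proof (NO case, full version p. 12)] -/
theorem eq_target_sub_of_isSolution (c : CVPInstance) {w : Fin c.I.n → ℤ}
    (hxw : c.targetE - intVecToEuclidean c.I.n w ∈ c.I.lattice)
    (hw : 2 * ‖intVecToEuclidean c.I.n w‖ < minNorm c.I.lattice) {v : Fin c.I.n → ℤ}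
    (hv : CVP.IsSolution (fun _ => 1) c v) : v = c.target - w := by
  obtain ⟨hvL, hvd⟩ := hv
  rw [one_mul] at hvd
  have hdist : dist (intVecToEuclidean c.I.n v) c.targetE ≤ ‖intVecToEuclidean c.I.n w‖ :=
    hvd.trans (infDist_targetE_le_norm c hxw)
  by_contra hne
  have hne' : intVecToEuclidean c.I.n v - (c.targetE - intVecToEuclidean c.I.n w) ≠ 0 := by
    intro h
    apply hne
    apply intVecToEuclidean_injective c.I.n
    rw [map_sub]
    exact sub_eq_zero.1 h
  have hmem : intVecToEuclidean c.I.n v - (c.targetE - intVecToEuclidean c.I.n w) ∈ c.I.lattice :=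
    sub_mem hvL hxw
  have hmin : minNorm c.I.lattice ≤ ‖intVecToEuclidean c.I.n v - (c.targetE - intVecToEuclidean c.I.n w)‖ :=
    csInf_le ⟨0, by rintro _ ⟨z, -, rfl⟩; exact norm_nonneg z⟩ ⟨_, ⟨hmem, hne'⟩, rfl⟩
  have htri : ‖intVecToEuclidean c.I.n v - (c.targetE - intVecToEuclidean c.I.n w)‖ ≤
      2 * ‖intVecToEuclidean c.I.n w‖ := by
    rw [← sub_add]
    refine (norm_add_le _ _).trans ?_
    rw [← dist_eq_norm, two_mul]
    exact add_le_add hdist le_rfl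
  linarith

/-- **NO case, the call is admissible** (Peikert 2009, proof of Thm. 3.1, NO case, in scale-free form).
Let `(B, x)` be a CVP instance with `B` nonsingular whose Gram–Schmidt norms are all `≥ s > 0`, let
`0 < d₀ ≤ λ₁(L(B))` (for a NO instance of `GapSVP_{ζ,γ}`: `d₀ = γ(n)·d < λ₁`, `s = 1`), and let the
rational parameter `r` satisfy `r ≥ q√(2n)/d₀` and `r·s ≥ f(n)√(log n)`. If `dist(x, L(B)) ≤ αq/(√2 r)`
then `((B, x), r)` is `f`-admissible: the smoothing condition `r ≥ √2 q η_{2⁻ⁿ}(Λ*)` is Lemma 2.7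
(`η_{2⁻ⁿ}(Λ*) ≤ √n/λ₁(Λ)`, the tree theorem `smoothingParameter_two_pow_neg_le_holds` applied to `Λ*`,
with `(Λ*)* = Λ`). Scale-free: the hypotheses are invariant under `(B, x, r, s, d₀) ↦ (MB, Mx, r/M, Ms, Md₀)`.
[cite: Peikert2009, Thm. 3.1 proof (NO case, full version p. 12) with Lemma 2.7] -/
theorem bddAdmissible_of_le_minNorm {q : ℕ → ℕ} {α f : ℕ → ℝ} (c : CVPInstance) (r : ℚ)
    (hI : c.I.IsNonsingular) {s d₀ : ℝ} (hGS : ∀ i, s ≤ ‖InnerProductSpace.gramSchmidt ℝ c.I.vec i‖)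
    (hd₀ : 0 < d₀) (hmin : d₀ ≤ minNorm c.I.lattice)
    (hr : q c.I.n * Real.sqrt (2 * c.I.n) / d₀ ≤ r) (hr0 : 0 < r)
    (hfr : f c.I.n * Real.sqrt (Real.log c.I.n) ≤ r * s)
    (hdist : infDist c.targetE c.I.lattice ≤ α c.I.n * q c.I.n / (Real.sqrt 2 * r)) :
    BDDAdmissible q α f (c, r) := by
  refine ⟨hI, hr0, fun i => hfr.trans ?_, ?_, hdist⟩
  · exact mul_le_mul_of_nonneg_left (hGS i) (by exact_mod_cast hr0.le)
  · exact sqrt_two_mul_mul_smoothingParameter_dual_le hI (Nat.cast_nonneg _) hd₀ hmin hr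

/-! ### YES instances: a short lattice shift is statistically hidden from `R` -/

section Hiding

variable {G : Type*} [AddCommGroup G]

omit [AddCommGroup G] in
/-- The mass a `PMF` gives to a set is finite. [folklore] -/
theorem toOuterMeasure_ne_top (W : PMF G) (A : Set G) : W.toOuterMeasure A ≠ ∞ :=
  ne_top_of_le_ne_top ENNReal.one_ne_top
    ((W.toOuterMeasure.mono (Set.subset_univ A)).trans_eq
      ((W.toOuterMeasure_apply_eq_one_iff Set.univ).2 (Set.subset_univ _)))

/-- **Statistical hiding of a shift, event form** (the [GG00] principle behind the YES case of
Peikert 2009, Thm. 3.1: "`v` is statistically hidden and `R` must guess incorrectly with some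
non-negligible probability"). Let `W` be any distribution on an additive group, `z` a shift and `A` an
event that is incompatible with its own shift (`w ∈ A ⇒ z + w ∉ A`). Then
`W(A) ≤ (1 + Δ(W, z + W))/2`: indeed `W(A) + (z + W)(A) = W(A) + W(A - z) ≤ 1` by disjointness and
`W(A) - (z + W)(A) ≤ Δ(W, z + W)`. [cite: Peikert2009, Thm. 3.1 proof (YES case, full version p. 12); GoldreichGoldwasser2000] -/
theorem toReal_toOuterMeasure_le_of_shift (W : PMF G) (z : G) (A : Set G)
    (hA : ∀ w ∈ A, z + w ∉ A) :
    (W.toOuterMeasure A).toReal ≤ (1 + W.tvDist (W.map (z + ·))) / 2 := by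
  have hpre : (W.map (z + ·)).toOuterMeasure A = W.toOuterMeasure ((z + ·) ⁻¹' A) :=
    PMF.toOuterMeasure_map_apply _ _ _
  have hdisj : Disjoint A ((z + ·) ⁻¹' A) :=
    Set.disjoint_left.2 fun w hw hw' => hA w hw hw'
  have hsum : W.toOuterMeasure A + W.toOuterMeasure ((z + ·) ⁻¹' A) ≤ 1 := by
    letI : MeasurableSpace G := ⊤
    have hmeas : ∀ s : Set G, MeasurableSet s := fun s => MeasurableSpace.measurableSet_top
    rw [← W.toMeasure_apply_eq_toOuterMeasure_apply (hmeas A),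
      ← W.toMeasure_apply_eq_toOuterMeasure_apply (hmeas ((z + ·) ⁻¹' A)),
      ← MeasureTheory.measure_union hdisj (hmeas _)]
    exact MeasureTheory.prob_le_one
  have h1 : (W.toOuterMeasure A).toReal + ((W.map (z + ·)).toOuterMeasure A).toReal ≤ 1 := by
    rw [hpre, ← ENNReal.toReal_add (toOuterMeasure_ne_top W _) (toOuterMeasure_ne_top W _),
      ← ENNReal.toReal_one]
    exact ENNReal.toReal_mono ENNReal.one_ne_top hsum
  have h2 := PMF.toReal_toOuterMeasure_sub_le_tvDist W (W.map (z + ·)) A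
  linarith

/-- **Statistical hiding of a shift, averaged over independent coins**: for coins `c ∼ μ` drawn
independently of `w ∼ W` and a family of events `A c`, each incompatible with its own `z`-shift,
`Pr_{c, w}[w ∈ A c] ≤ (1 + Δ(W, z + W))/2`. (Peikert 2009, proof of Thm. 3.1, YES case: the bound
`Pr[R(x) = x - w] ≤ 1 - 1/poly(n)` holds for ANY randomised `R`, its coins being independent of `w`.)
[cite: Peikert2009, Thm. 3.1 proof (YES case, full version p. 12)] -/
theorem toReal_toOuterMeasure_bind_le_of_shift {C : Type*} (μ : PMF C) (W : PMF G) (z : G)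
    (A : C → Set G) (hA : ∀ c, ∀ w ∈ A c, z + w ∉ A c) :
    ((μ.bind fun c => W.map fun w => (c, w)).toOuterMeasure {p | p.2 ∈ A p.1}).toReal ≤
      (1 + W.tvDist (W.map (z + ·))) / 2 := by
  rw [PMF.toReal_toOuterMeasure_bind_apply]
  have hc : ∀ c, ((W.map fun w => (c, w)).toOuterMeasure {p : C × G | p.2 ∈ A p.1}).toReal ≤
      (1 + W.tvDist (W.map (z + ·))) / 2 := fun c => by
    rw [PMF.toOuterMeasure_map_apply]
    exact toReal_toOuterMeasure_le_of_shift W z _ (hA c)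
  have hsum : Summable fun c => (μ c).toReal * ((W.map fun w => (c, w)).toOuterMeasure
      {p : C × G | p.2 ∈ A p.1}).toReal :=
    PMF.summable_toReal_mul_of_abs_le_one μ fun c => by
      rw [abs_of_nonneg ENNReal.toReal_nonneg]
      exact PMF.toReal_toOuterMeasure_le_one _ _
  calc ∑' c, (μ c).toReal * ((W.map fun w => (c, w)).toOuterMeasure {p : C × G | p.2 ∈ A p.1}).toReal
      ≤ ∑' c, (μ c).toReal * ((1 + W.tvDist (W.map (z + ·))) / 2) :=
        hsum.tsum_le_tsum (fun c => mul_le_mul_of_nonneg_left (hc c) ENNReal.toReal_nonneg)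
          ((PMF.summable_coe_toReal μ).mul_right _)
    _ = (1 + W.tvDist (W.map (z + ·))) / 2 := by
        rw [tsum_mul_right, PMF.tsum_coe_toReal, one_mul]

end Hiding

/-- **YES case of Thm. 3.1: `R` cannot name the perturbation** (Peikert 2009, proof of Thm. 3.1, YES
case, the core inequality `Pr[R(x) = x - w] ≤ (1 + Δ(w, z + w))/2 ≤ 1 - 1/poly(n)`). The view of the
BDD solver is a function `red w` of the perturbation `w ∈ ℤⁿ` that is invariant under the shift by the
lattice vector `z ≠ 0` (`x = w mod B = (z + w) mod B`); its answer is any function `run` of that view and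
of coins `c ∼ μ` independent of `w ∼ W`, decoded by any `dec`; it "names the perturbation" when the
decoded answer is `x - w` (`lift (red w) - w`, `lift` reading the view back in `ℤⁿ`). Then
`Pr_{c, w}[dec (run (red w) c) = lift (red w) - w] ≤ (1 + Δ(W, z + W))/2`, because naming `w` and naming
`z + w` from the same view are incompatible events. [cite: Peikert2009, Thm. 3.1 proof (YES case, full version p. 12)] -/
theorem prob_names_perturbation_le {n : ℕ} {C X β : Type*} (μ : PMF C) (W : PMF (Fin n → ℤ))
    (red : (Fin n → ℤ) → X) (lift : X → (Fin n → ℤ)) (run : X → C → β) (dec : β → (Fin n → ℤ))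
    {z : Fin n → ℤ} (hz : z ≠ 0) (hred : ∀ w, red (z + w) = red w) :
    ((μ.bind fun c => W.map fun w => (c, w)).toOuterMeasure
        {p | dec (run (red p.2) p.1) = lift (red p.2) - p.2}).toReal ≤
      (1 + W.tvDist (W.map (z + ·))) / 2 := by
  refine toReal_toOuterMeasure_bind_le_of_shift μ W z
    (fun c => {w | dec (run (red w) c) = lift (red w) - w}) fun c w hw hw' => hz ?_
  simp only [Set.mem_setOf_eq, hred] at hw hw'
  rw [hw] at hw'
  -- `lift (red w) - w = lift (red w) - (z + w)` forces `z = 0`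
  have := sub_right_injective hw'
  simpa using this

/-! ### Peikert's parameters on a NO instance -/

/-- For `n ≥ 2`, `1/2 < √(log n)` (natural logarithm). [folklore] -/
theorem half_lt_sqrt_log {n : ℕ} (hn : 2 ≤ n) : 1 / 2 < Real.sqrt (Real.log n) := by
  have hlog2 : (1 / 2 : ℝ) < Real.log 2 := by
    have := Real.log_two_gt_d9
    linarith
  have hlog : (1 / 2 : ℝ) < Real.log n :=
    hlog2.trans_le (Real.log_le_log (by norm_num) (by exact_mod_cast hn))
  have h14 : (1 / 2 : ℝ) = Real.sqrt (1 / 4) := by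
    rw [show (1 / 4 : ℝ) = (1 / 2) ^ 2 by norm_num, Real.sqrt_sq (by norm_num)]
  rw [h14]
  exact Real.sqrt_lt_sqrt (by norm_num) (by linarith)

/-- Peikert's perturbation radius `d' = d·√(n/(4 log n)) = d√n/(2√(log n))` (proof of Thm. 3.1,
step 1: "Choose a point `w` uniformly at random from the ball `d'·Bₙ`"). [cite: Peikert2009, Thm. 3.1 proof (step 1, full version p. 12)] -/
def perturbRadius (n : ℕ) (d : ℝ) : ℝ :=
  d * Real.sqrt n / (2 * Real.sqrt (Real.log n))
set_option maxHeartbeats 400000 in -- buildfix (bf3-g27): 160k/180k FAIL, 200k PASS at accept time; line-neutral budget line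
/-- **The NO case of Thm. 3.1 with Peikert's parameters** (full version p. 12). Let `(B, d)` be a NO
instance of `GapSVP_{ζ,γ}` of dimension `n ≥ 2` (so `minᵢ‖b̃ᵢ‖ ≥ 1`, `1 ≤ d ≤ ζ/γ`, `λ₁ > γd`), in the
regime `α ∈ (0,1)`, `γ ≥ 2n/(α√(log n))` (twice the printed `n/(α√(log n))`, the factor `2` paying for a
rational parameter `r` anywhere within a factor `2` of the printed `q√(2n)/(γd)`), `γ ≤ ζ`,
`q ≥ ζ·f·√(log n)/√n` with `f ≥ 0` (the printed `q ≥ (ζ/√n)·ω(√(log n))`) and `q ≥ 1`. Then for every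
perturbation `w ∈ ℤⁿ` with `‖w‖ ≤ d' = d√n/(2√(log n))` and every target `x` with `x - w ∈ L(B)`
(e.g. `x = w mod B`): (1) the call `((B, x), r)` is `f`-admissible — `r ≥ q√(2n)/ζ ≥ √2 f√(log n)`
(condition of Prop. 2.8 on the reversed dual basis, `maxᵢ‖d̃ᵢ‖ = 1/minᵢ‖b̃ᵢ‖ ≤ 1`), `r ≥ √2 q η_{2⁻ⁿ}(Λ*)`
(Lemma 2.7), `dist(x, Λ) ≤ ‖w‖ ≤ d' ≤ αγd/(4√n) ≤ αq/(√2 r)` — and (2) since `λ₁ > γd > 2d' ≥ 2‖w‖`, the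
only admissible answer (`CVP.IsSolution 1`) is `v = x - w`. [cite: Peikert2009, Thm. 3.1 proof (NO case, full version p. 12)] -/
theorem no_case {q : ℕ → ℕ} {α f ζ γ : ℕ → ℝ} {p : GapSVPInstance} (hp : p ∈ GapSVPZeta.no ζ γ)
    (hn : 2 ≤ p.1.n) (hα : 0 < α p.1.n) (hα1 : α p.1.n < 1) (hf : 0 ≤ f p.1.n) (hq1 : 1 ≤ q p.1.n)
    (hγ : 2 * p.1.n / (α p.1.n * Real.sqrt (Real.log p.1.n)) ≤ γ p.1.n)
    (hq : ζ p.1.n * f p.1.n * Real.sqrt (Real.log p.1.n) / Real.sqrt p.1.n ≤ q p.1.n)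
    (x w : Fin p.1.n → ℤ)
    (hxw : intVecToEuclidean p.1.n x - intVecToEuclidean p.1.n w ∈ p.1.lattice)
    (hw : ‖intVecToEuclidean p.1.n w‖ ≤ perturbRadius p.1.n p.2) (r : ℚ)
    (hr : q p.1.n * Real.sqrt (2 * p.1.n) / (γ p.1.n * p.2) ≤ r)
    (hr2 : (r : ℝ) ≤ 2 * (q p.1.n * Real.sqrt (2 * p.1.n) / (γ p.1.n * p.2))) :
    BDDAdmissible q α f (⟨p.1, x⟩, r) ∧
      ∀ v, CVP.IsSolution (fun _ => 1) ⟨p.1, x⟩ v → v = x - w := by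
  obtain ⟨⟨hI, -, hGS, hd1, hdζ⟩, hno⟩ := hp
  -- notation and positivity
  set d : ℝ := (p.2 : ℝ) with hddef
  set L := Real.sqrt (Real.log p.1.n) with hLdef
  set S := Real.sqrt (p.1.n : ℝ) with hSdef
  have hn2 : (2 : ℝ) ≤ p.1.n := by exact_mod_cast hn
  have hLpos : 0 < L := lt_trans (by norm_num) (half_lt_sqrt_log hn)
  have hS1 : 1 ≤ S := by
    rw [hSdef, show (1 : ℝ) = Real.sqrt 1 by simp]
    exact Real.sqrt_le_sqrt (by linarith)
  have hSpos : 0 < S := lt_of_lt_of_le one_pos hS1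
  have hSsq : S * S = p.1.n := Real.mul_self_sqrt (by linarith)
  have hS2n : Real.sqrt (2 * (p.1.n : ℝ)) = Real.sqrt 2 * S := Real.sqrt_mul (by norm_num) _
  have hsqrt2pos : 0 < Real.sqrt 2 := Real.sqrt_pos.2 (by norm_num)
  have hsqrt2sq : Real.sqrt 2 * Real.sqrt 2 = 2 := Real.mul_self_sqrt (by norm_num)
  have hdpos : 0 < d := lt_of_lt_of_le one_pos hd1
  have hγ0 : 0 < 2 * p.1.n / (α p.1.n * L) := div_pos (by linarith) (mul_pos hα hLpos)
  have hγpos : 0 < γ p.1.n := lt_of_lt_of_le hγ0 hγ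
  have hd₀pos : 0 < γ p.1.n * d := mul_pos hγpos hdpos
  have hqpos : (0 : ℝ) < q p.1.n := by exact_mod_cast hq1
  have hq0 : (0 : ℝ) ≤ q p.1.n := hqpos.le
  -- `γ d ≤ ζ`
  have hγdζ : γ p.1.n * d ≤ ζ p.1.n := by
    have := (le_div_iff₀ hγpos).1 hdζ
    linarith [mul_comm (γ p.1.n) d]
  -- the printed parameter `r₀ = q√(2n)/(γd)` and the window `r₀ ≤ r ≤ 2 r₀`
  set r₀ : ℝ := q p.1.n * Real.sqrt (2 * p.1.n) / (γ p.1.n * d) with hr₀def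
  have hr₀pos : 0 < r₀ := div_pos (mul_pos hqpos (Real.sqrt_pos.2 (by positivity))) hd₀pos
  have hrpos : (0 : ℝ) < r := lt_of_lt_of_le hr₀pos hr
  have hrpos' : 0 < r := by exact_mod_cast hrpos
  -- (GPV condition) `f √(log p.1.n) ≤ r`: `r ≥ r₀ ≥ q√(2n)/ζ ≥ √2 f √(log p.1.n) ≥ f √(log p.1.n)`
  have hfr : f p.1.n * L ≤ (r : ℝ) * 1 := by
    rw [mul_one]
    refine le_trans ?_ hr
    rw [hr₀def, le_div_iff₀ hd₀pos]
    have hq' : ζ p.1.n * f p.1.n * L ≤ q p.1.n * S := (div_le_iff₀ hSpos).1 hq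
    have h1 : f p.1.n * L * (γ p.1.n * d) ≤ f p.1.n * L * ζ p.1.n :=
      mul_le_mul_of_nonneg_left hγdζ (mul_nonneg hf hLpos.le)
    have h2 : f p.1.n * L * ζ p.1.n ≤ q p.1.n * S := by linarith [mul_comm (f p.1.n * L) (ζ p.1.n)]
    have h3 : q p.1.n * S ≤ q p.1.n * Real.sqrt (2 * p.1.n) := by
      rw [hS2n]
      have : S ≤ Real.sqrt 2 * S := by
        have h12 : (1 : ℝ) ≤ Real.sqrt 2 := by
          rw [show (1 : ℝ) = Real.sqrt 1 by simp]; exact Real.sqrt_le_sqrt (by norm_num)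
        nlinarith
      exact mul_le_mul_of_nonneg_left this hq0
    linarith
  -- (distance condition) `‖w‖ ≤ d' ≤ α q/(√2 r)`
  have hdist : infDist (CVPInstance.targetE ⟨p.1, x⟩) p.1.lattice ≤ α p.1.n * q p.1.n / (Real.sqrt 2 * r) := by
    refine (infDist_targetE_le_norm ⟨p.1, x⟩ hxw).trans (hw.trans ?_)
    show perturbRadius p.1.n d ≤ α p.1.n * q p.1.n / (Real.sqrt 2 * r)
    rw [perturbRadius, div_le_div_iff₀ (mul_pos two_pos hLpos) (mul_pos hsqrt2pos hrpos)]
    have hγ' : 2 * (p.1.n : ℝ) ≤ γ p.1.n * (α p.1.n * L) := (div_le_iff₀ (mul_pos hα hLpos)).1 hγ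
    have hr2' : (r : ℝ) * (γ p.1.n * d) ≤ 2 * (q p.1.n * (Real.sqrt 2 * S)) := by
      rw [← hS2n]
      have := (le_div_iff₀ hd₀pos).1 (show (r : ℝ) ≤ 2 * (q p.1.n * Real.sqrt (2 * p.1.n)) / (γ p.1.n * d) by
        rw [mul_div_assoc]; exact hr2)
      linarith
    have key : d * S * (Real.sqrt 2 * r) * (γ p.1.n * d) ≤ α p.1.n * q p.1.n * (2 * L) * (γ p.1.n * d) := by
      calc d * S * (Real.sqrt 2 * r) * (γ p.1.n * d)
          = d * S * Real.sqrt 2 * (r * (γ p.1.n * d)) := by ring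
        _ ≤ d * S * Real.sqrt 2 * (2 * (q p.1.n * (Real.sqrt 2 * S))) :=
            mul_le_mul_of_nonneg_left hr2' (by positivity)
        _ = 2 * d * q p.1.n * (2 * p.1.n) := by
            have : S * Real.sqrt 2 * (Real.sqrt 2 * S) = 2 * p.1.n := by
              calc S * Real.sqrt 2 * (Real.sqrt 2 * S) = (Real.sqrt 2 * Real.sqrt 2) * (S * S) := by ring
                _ = 2 * p.1.n := by rw [hsqrt2sq, hSsq]
            calc d * S * Real.sqrt 2 * (2 * (q p.1.n * (Real.sqrt 2 * S)))
                = 2 * d * q p.1.n * (S * Real.sqrt 2 * (Real.sqrt 2 * S)) := by ring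
              _ = 2 * d * q p.1.n * (2 * p.1.n) := by rw [this]
        _ ≤ 2 * d * q p.1.n * (γ p.1.n * (α p.1.n * L)) :=
            mul_le_mul_of_nonneg_left hγ' (by positivity)
        _ = α p.1.n * q p.1.n * (2 * L) * (γ p.1.n * d) := by ring
    exact le_of_mul_le_mul_right key hd₀pos
  refine ⟨bddAdmissible_of_le_minNorm ⟨p.1, x⟩ r hI hGS hd₀pos hno.le hr hrpos' hfr hdist, ?_⟩
  -- (forced answer) `2‖w‖ ≤ 2d' = d S/L < γ d < λ₁`
  intro v hv
  refine eq_target_sub_of_isSolution ⟨p.1, x⟩ hxw (lt_of_le_of_lt ?_ hno) hv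
  have hγ' : 2 * (p.1.n : ℝ) ≤ γ p.1.n * (α p.1.n * L) := (div_le_iff₀ (mul_pos hα hLpos)).1 hγ
  calc 2 * ‖intVecToEuclidean p.1.n w‖ ≤ 2 * perturbRadius p.1.n d := by linarith
    _ = d * S / L := by
        rw [perturbRadius, ← hSdef, ← hLdef]
        field_simp
    _ ≤ γ p.1.n * d := by
        rw [div_le_iff₀ hLpos]
        have h1 : γ p.1.n * (α p.1.n * L) ≤ γ p.1.n * L := by
          have : α p.1.n * L ≤ L := by nlinarith
          exact mul_le_mul_of_nonneg_left this hγpos.le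
        have hSn : S ≤ p.1.n := by nlinarith
        nlinarith

end Peikert2009

open Peikert2009

/-! ### The approximation factor and the modulus bound of the assembly -/

section Parameters

variable (q : ℕ → ℕ) (α : ℕ → ℝ)

/-- The approximation factor used in the assembly: `γ(n) = max(1, 2n/(α(n)√(log n)))`, twice Peikert's
minimal admissible factor `n/(α√(log n))` of Thm. 3.1, floored at `1` (junk-free in small dimension).
[cite: Peikert2009, Thm. 3.1] -/
def peikertGamma (n : ℕ) : ℝ :=
  max 1 (2 * n / (α n * Real.sqrt (Real.log n)))

/-- `1 ≤ γ(n)`. [folklore] -/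
theorem one_le_peikertGamma (n : ℕ) : 1 ≤ peikertGamma α n :=
  le_max_left _ _

/-- `2n/(α(n)√(log n)) ≤ γ(n)`. [folklore] -/
theorem le_peikertGamma (n : ℕ) : 2 * n / (α n * Real.sqrt (Real.log n)) ≤ peikertGamma α n :=
  le_max_right _ _

/-- `γ = Õ(n/α)`: eventually (`n ≥ 2`, `α(n) ∈ (0,1)`) `γ(n) ≤ 4 · (n/α(n))`. [cite: Peikert2009, Thm. 3.1 (`γ ≥ n/(α√(log n))`)] -/
theorem isSoftBigO_peikertGamma (hα : ∀ᶠ n : ℕ in atTop, 0 < α n ∧ α n < 1) :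
    IsSoftBigO (peikertGamma α) (fun n => n / α n) := by
  refine IsSoftBigO.of_isBigO (IsBigO.of_bound 4 ?_)
  filter_upwards [hα, eventually_ge_atTop 2] with n hαn hn
  have hα0 : 0 < α n := hαn.1
  have hna : 1 ≤ (n : ℝ) / α n := by
    rw [le_div_iff₀ hα0]
    have : (2 : ℝ) ≤ n := by exact_mod_cast hn
    linarith [hαn.2]
  have hs : 1 / 2 < Real.sqrt (Real.log n) := half_lt_sqrt_log hn
  have hspos : 0 < Real.sqrt (Real.log n) := lt_trans (by norm_num) hs
  have hfrac : 2 * n / (α n * Real.sqrt (Real.log n)) ≤ 4 * (n / α n) := by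
    rw [div_le_iff₀ (mul_pos hα0 hspos)]
    have h1 : 4 * (n / α n) * (α n * Real.sqrt (Real.log n)) = 4 * n * Real.sqrt (Real.log n) := by
      field_simp
    rw [h1]
    have : (0 : ℝ) ≤ n := by positivity
    nlinarith
  have hγ : peikertGamma α n ≤ 4 * (n / α n) := max_le (by linarith) hfrac
  have hγ0 : 0 ≤ peikertGamma α n := le_trans zero_le_one (one_le_peikertGamma α n)
  rw [Real.norm_of_nonneg hγ0, Real.norm_of_nonneg (le_trans zero_le_one hna)]
  exact hγ

/-- Under S20's modulus hypothesis for `γ = peikertGamma α`, eventually `2 ≤ q(n)`: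
`q ≥ ζ f √(log n)/√n ≥ γ f √(log n)/√n ≥ (2n/(α√(log n))) f √(log n)/√n = 2√n f/α ≥ 2` (this is the
hypothesis `q ≥ 2` of Prop. 3.2, implied by the hypotheses of Thm. 3.1). [cite: Peikert2009, Prop. 3.2 (`q(n) ≥ 2`)] -/
theorem eventually_two_le_modulus (hα : ∀ᶠ n : ℕ in atTop, 0 < α n ∧ α n < 1) {ζ f : ℕ → ℝ}
    (hf : Tendsto f atTop atTop)
    (hζ : ∀ᶠ n : ℕ in atTop, peikertGamma α n ≤ ζ n ∧
      ζ n * f n * Real.sqrt (Real.log n) / Real.sqrt n ≤ q n) :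
    ∀ᶠ n : ℕ in atTop, 2 ≤ q n := by
  filter_upwards [hα, hζ, hf.eventually_ge_atTop 1, eventually_ge_atTop 2] with n hαn hζn hfn hn
  have hα0 : 0 < α n := hαn.1
  have hn2 : (2 : ℝ) ≤ n := by exact_mod_cast hn
  set L := Real.sqrt (Real.log n) with hLdef
  set s := Real.sqrt (n : ℝ) with hsdef
  have hLpos : 0 < L := lt_trans (by norm_num) (half_lt_sqrt_log hn)
  have hspos : 0 < s := Real.sqrt_pos.2 (by linarith)
  have hsq : (n : ℝ) = s * s := by rw [hsdef, Real.mul_self_sqrt (by linarith)]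
  have hγle : 2 * n / (α n * L) ≤ ζ n := le_trans (le_max_right _ _) hζn.1
  have hA : 2 * (n : ℝ) ≤ ζ n * (α n * L) := (div_le_iff₀ (mul_pos hα0 hLpos)).1 hγle
  have hB : ζ n * f n * L ≤ (q n : ℝ) * s := (div_le_iff₀ hspos).1 hζn.2
  have hζ0 : 0 ≤ ζ n := le_trans (by positivity) hγle
  have hC : ζ n * L ≤ ζ n * f n * L := by
    have : 0 ≤ ζ n * L * (f n - 1) := mul_nonneg (mul_nonneg hζ0 hLpos.le) (by linarith)
    nlinarith
  have hD : 2 * (n : ℝ) ≤ ζ n * L := by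
    have : 0 ≤ ζ n * L * (1 - α n) := mul_nonneg (mul_nonneg hζ0 hLpos.le) (by linarith [hαn.2])
    nlinarith
  have hE : 2 * (n : ℝ) ≤ q n * s := le_trans hD (le_trans hC hB)
  rw [hsq] at hE
  have h2s : 2 * s ≤ (q n : ℝ) := le_of_mul_le_mul_right (by linarith) hspos
  have hs1 : 1 ≤ s := by
    rw [hsdef, show (1 : ℝ) = Real.sqrt 1 by simp]
    exact Real.sqrt_le_sqrt (by linarith)
  exact_mod_cast (show (2 : ℝ) ≤ q n by linarith)

end Parameters

/-! ### Assembly: pqc.S20 from the two printed components -/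

section Assembly

variable (q : ℕ → ℕ) [∀ n, NeZero (q n)] (α : ℕ → ℝ) (m : ℕ → ℕ)

/-- **pqc.S20 from the two printed components of the proof of Thm. 3.1** (Peikert 2009, STOC §3.1.2,
p. 337: "Conceptually, the reduction claimed in Theorem 3.1 has two components. The first piece reduces
GapSVP to a version of the bounded-distance decoding (BDD) problem. The second part is the reduction `R`
from BDD to LWE described in Proposition 3.2, with a concrete implementation of the oracle `D`"), in
machine form on the oracle model of `LWEHardness.lean`; no named fact is introduced, the components
are the explicit hypotheses:

* `h₁` — FIRST COMPONENT (proof of Thm. 3.1, full version pp. 11–12): for `(q, α, m)` polynomial-time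
  computable from `1ⁿ`, eventually `α ∈ (0,1)`, and `γ, ζ, f` with `f → ∞` and eventually
  `2n/(α√(log n)) ≤ γ ≤ ζ`, `ζ f √(log n)/√n ≤ q`, every probabilistic polynomial-time oracle algorithm
  `R` (string output) yields a probabilistic polynomial-time oracle algorithm `M` (sample a
  perturbation `w` of norm `≤ d'`, reduce it modulo `B`, run `R` with a rational `r` within a factor
  `2` of `q√(2n)/(γd)`, accept iff some answer differs from `x - w`, `poly(n)` times) such that for
  every oracle `O`, if `R^O` solves the `f`-admissible BDD inputs with overwhelming probability then,
  eventually in the dimension, `M^O` decides `GapSVP_{ζ,γ}` with probability `≥ 2/3`. Its mathematics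
  is PROVED above: `Peikert2009.no_case` (NO instances: the call is admissible and its answer is
  forced, Lemma 2.7) and `Peikert2009.prob_names_perturbation_le` (YES instances: the perturbation is
  statistically hidden, the [GG00] Lemma 2.1 principle); what `h₁` adds is the machine `M` itself, a
  perturbation law `W` of `ℓ₂`-width `d'` samplable to negligible error with
  `Δ(W, z + W) ≤ 1 - 1/poly(n)` for `‖z‖ ≤ d` (Lemma 2.1), and the polynomial repetition.
* `h₂` — SECOND COMPONENT (Prop. 3.2 = Regev 2009 Lemma 3.4, with the `D_{Λ*,r}` oracle implemented
  by the GPV sampler of Prop. 2.8 on the reversed dual basis, Lemma 2.3, at `ε = 2⁻ⁿ`, and the LWE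
  oracle of the tree — average-case, `Ψ̄_α`, `m(n)` samples — normalised by Regev 2009, Lemmas 3.5–3.7,
  4.1, 4.3): for `(q, α, m)` polynomial-time computable, `m` polynomially bounded, eventually
  `q ≥ 2` and `α ∈ (0,1)`, and every `f → ∞`, ONE probabilistic polynomial-time oracle algorithm `R`
  solves every `f`-admissible input with overwhelming probability for every oracle solving
  search-`LWE_{q,Ψ̄_α}` (`Peikert2009.SolvesBDD`).

Glue: `γ = peikertGamma α = max(1, 2n/(α√(log n)))` (`≥ 1`, `Õ(n/α)`); given `ζ, f` as in S20, `h₂`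
yields `R` for the growth witness `f` (its hypothesis `q ≥ 2` holds eventually,
`eventually_two_le_modulus`), and `h₁` turns `R` into the decider `M`.
[cite: Peikert2009, Thm. 3.1 (proof, STOC §3.1.2; full version pp. 10–12)] -/
theorem peikert_gapSVPZeta_to_lwe_classical_of_components
    (h₁ : ∀ (_ : IsPolyTimeParams q α m) (_ : ∀ᶠ n : ℕ in atTop, 0 < α n ∧ α n < 1) (γ ζ f : ℕ → ℝ),
      Tendsto f atTop atTop →
      (∀ᶠ n : ℕ in atTop, 2 * n / (α n * Real.sqrt (Real.log n)) ≤ γ n ∧ γ n ≤ ζ n ∧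
        ζ n * f n * Real.sqrt (Real.log n) / Real.sqrt n ≤ q n) →
      ∀ (R : OracleAlg (List Bool)) (coinsR fuelR : Polynomial ℕ), R.IsPolyTime (encodingList Bool) →
        ∃ (M : OracleAlg Bool) (coins fuel : Polynomial ℕ), M.IsPolyTime encodingBoolBool ∧
          ∀ O : Oracle, SolvesBDD q α f R coinsR fuelR O →
            ∀ᶠ n in atTop, ∀ p : GapSVPInstance, p.1.n = n →
              (p ∈ GapSVPZeta.yes ζ γ → 2 / 3 ≤ M.randRun O coins fuel p.encode (some true)) ∧
              (p ∈ GapSVPZeta.no ζ γ → 2 / 3 ≤ M.randRun O coins fuel p.encode (some false)))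
    (h₂ : ∀ (_ : IsPolyTimeParams q α m) (_ : IsPolyBounded m) (_ : ∀ᶠ n : ℕ in atTop, 2 ≤ q n)
      (_ : ∀ᶠ n : ℕ in atTop, 0 < α n ∧ α n < 1) (f : ℕ → ℝ), Tendsto f atTop atTop →
      ∃ (R : OracleAlg (List Bool)) (coins fuel : Polynomial ℕ), R.IsPolyTime (encodingList Bool) ∧
        ∀ O : Oracle, O.SolvesSearchLWE q (fun n => discretizedGaussian (q n) (α n)) m (2 / 3) →
          SolvesBDD q α f R coins fuel O) :
    peikert_gapSVPZeta_to_lwe_classical q α m := by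
  intro hpar hm hα
  refine ⟨peikertGamma α, one_le_peikertGamma α, isSoftBigO_peikertGamma α hα, ?_⟩
  intro ζ f hf hζ
  have hq2 : ∀ᶠ n : ℕ in atTop, 2 ≤ q n := eventually_two_le_modulus q α hα hf hζ
  obtain ⟨R, coinsR, fuelR, hRpoly, hR⟩ := h₂ hpar hm hq2 hα f hf
  have hbounds : ∀ᶠ n : ℕ in atTop, 2 * n / (α n * Real.sqrt (Real.log n)) ≤ peikertGamma α n ∧
      peikertGamma α n ≤ ζ n ∧ ζ n * f n * Real.sqrt (Real.log n) / Real.sqrt n ≤ q n :=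
    hζ.mono fun n hn => ⟨le_peikertGamma α n, hn.1, hn.2⟩
  obtain ⟨M, coins, fuel, hMpoly, hM⟩ :=
    h₁ hpar hα (peikertGamma α) ζ f hf hbounds R coinsR fuelR hRpoly
  exact ⟨M, coins, fuel, hMpoly, fun O hO => hM O (hR O hO)⟩

end Assembly

end Literature.Computability.Cryptography

end
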